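import Summits.CriticalPhenomena.SAWScalingLimit.Theorems.SAWDefectDecoherenceBoundaryClosureRZigzagDiscretisationExitSide
import HarnessLib

/-!
# Crux `BoundaryClosureR` (stmt-CriticalPhenomena-14004), line `polygon-parity-squeeze`,
# stub `stub_innerPolygonsOfZigzag` (7b): exits from the boundary layer near a corner

Landing target:
`Summits/CriticalPhenomena/SAWScalingLimit/Theorems/SAWDefectDecoherenceBoundaryClosureRZigzagDiscretisationExitCorner.lean`
(`--supports stmt-CriticalPhenomena-14004`; building block of the registered stub
`stub_innerPolygonsOfZigzag`, the lattice half of the inner-polygon construction (IP)).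

Companion of `…ExitSide`: exits near a corner `c` (`δ c_v ∈ ball c (9r/8)`), along the normal walk
of a direction `n_j` within `60°` of both forms to be increased (resp. of both opposite forms):

* `exists_near_both` — two non-opposite forms have a direction near both;
* `eventually_exit_up_corner` — a kept face walks inward through kept faces to a face at distance
  `≥ r/16` from `Pᶜ` (convex corner: both forms increase; reflex corner: the passed form increases);
* `eventually_exit_down_corner` — a non-kept face walks outward through non-kept faces to a face at
  distance `≥ r/16` from `closure P`, within `r` of the start (convex corner: the failed form
  decreases; reflex corner: both forms decrease).

Sources: folklore.  No proposition is defined and no named fact is introduced.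
-/

noncomputable section

open scoped ComplexConjugate Topology
open Set Metric Filter
open Literature.Probability.LatticeModels Literature.Probability.RandomPlanarGeometry
  Literature.Probability.RandomPlanarGeometry.SAW
open Summit.CriticalPhenomena.SAWScalingLimit.Theorems.PolygonParitySqueeze.InnerZigzag
  (level_split level_add_smul halfPlane_eq_of_level_eq_zero)

namespace Summit.CriticalPhenomena.SAWScalingLimit.Theorems.PolygonParitySqueeze.ZigzagDiscretisation

/-- **Two non-opposite forms have a direction within `60°` of both.** [folklore] -/
theorem exists_near_both {k₁ k₂ : Fin 6} (hno : (innerNormal k₁ * conj (innerNormal k₂)).re ≠ -1) :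
    ∃ j : Fin 6, 1 / 2 ≤ (innerNormal j * conj (innerNormal k₁)).re ∧ 1 / 2 ≤ (innerNormal j * conj (innerNormal k₂)).re := by
  rcases inner_innerNormal_cases k₁ k₂ with ⟨h1, -⟩ | h1 | ⟨h1 | h1, -⟩
  · exact ⟨k₁, half_le_inner_self k₁, by rw [h1]; norm_num⟩
  · exact absurd h1 hno
  · exact ⟨k₁, half_le_inner_self k₁, by rw [h1]⟩
  · obtain ⟨j, hj1, hj2⟩ := exists_bisector h1
    exact ⟨j, by rw [hj1], by rw [hj2]⟩

/-- Inner products against an opposite form. [folklore] -/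
theorem inner_zdOpp_right (j k : Fin 6) :
    (innerNormal j * conj (innerNormal (zdOpp k))).re = -(innerNormal j * conj (innerNormal k)).re := by
  rw [innerNormal_zdOpp, map_neg, mul_neg, Complex.neg_re]

section Exits

variable {D : DobrushinDomain} {S : Set ℂ} {Cor : Finset ℂ} {κ : ℂ → Fin 6 × Fin 6 × Bool}
  {r ρ r₁ r₀ : ℝ} {Λ : ℝ → Finset HexVertex} {m m₀ : ℝ → ℤ} {a b : ℝ → Sym2 HexVertex}

/-- **Up-exit near a corner, eventually.** [folklore] -/
theorem eventually_exit_up_corner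
    (hA : AdmissibleFamily D ρ Λ m b) (hP : PinnedFlatRoot D Λ b (D.pt 0) a r₀ m₀)
    (hSo : IsOpen S) (hSD : S ⊆ D.carrier) (hr : 0 < r) (hrρ : r ≤ ρ / 16) (hrr₁ : r ≤ r₁ / 16) (hr₁r₀ : r₁ ≤ r₀)
    (hD0 : D.carrier ∩ ball (D.pt 0) r₁ = {z : ℂ | (D.pt 0).im < z.im} ∩ ball (D.pt 0) r₁)
    (hF : ∀ w ∈ frontier S, w ∉ ball (D.pt 1) (15 * ρ / 16) → w ∉ ball (D.pt 0) (15 * r₁ / 16) → w ∈ D.carrier)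
    (hdist : ρ + r₁ ≤ dist (D.pt 0) (D.pt 1))
    (hCor : ∀ c ∈ Cor, c ∈ frontier S)
    (hsep : ∀ c ∈ Cor, ∀ c' ∈ Cor, c ≠ c' → 4 * r ≤ dist c c')
    (hflat : ∀ z ∈ frontier S, (∀ c ∈ Cor, r ≤ dist z c) → ∃ k : Fin 6, S ∩ ball z (r / 2) = halfPlane k z ∩ ball z (r / 2))
    (Hκ : ∀ c ∈ Cor, ((κ c).2.2 = true ∧ S ∩ ball c (2 * r) = halfPlane (κ c).1 c ∩ halfPlane (κ c).2.1 c ∩ ball c (2 * r)) ∨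
      ((κ c).2.2 = false ∧ S ∩ ball c (2 * r) = (halfPlane (κ c).1 c ∪ halfPlane (κ c).2.1 c) ∩ ball c (2 * r))) :
    ∀ᶠ δ : ℝ in 𝓝[>] 0, ∀ c ∈ Cor, ∀ v ∈ zdLam S Cor κ r (D.pt 1) (D.pt 0) ρ r₁ Λ m m₀ δ,
      (δ : ℂ) * hexCenter v ∈ ball c (9 * r / 8) →
      ∃ (j : Fin 6) (n : ℕ), (∀ i ≤ n, zdWalk j v i ∈ zdLam S Cor κ r (D.pt 1) (D.pt 0) ρ r₁ Λ m m₀ δ) ∧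
        r / 16 ≤ infDist ((δ : ℂ) * hexCenter (zdWalk j v n)) Sᶜ := by
  have hiff := eventually_zdLam_iff_corner hA hP hSo hSD hr hrρ hrr₁ hr₁r₀ hD0 hF hdist hCor hsep hflat Hκ
  have hthr := eventually_zdThr_le_zdT hA hP ρ r₁
  have hδ1 : ∀ᶠ δ : ℝ in 𝓝[>] 0, δ ∈ Ioo (0 : ℝ) (r / 200) := Ioo_mem_nhdsGT (by positivity)
  have hSc : Sᶜ.Nonempty := by
    by_contra h
    rw [not_nonempty_iff_eq_empty, compl_empty_iff] at h
    exact D.toJordanDomain.carrier_ne_univ (univ_subset_iff.1 (h ▸ hSD))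
  filter_upwards [hiff, hthr, hδ1] with δ hiffδ hthrδ hδδ c hc v hv hpc
  obtain ⟨hδ, hδr⟩ := hδδ
  set x₁ := D.pt 1
  set x₀ := D.pt 0
  set p : ℂ := (δ : ℂ) * hexCenter v with hp
  have hpc' : dist p c < 9 * r / 8 := mem_ball.1 hpc
  obtain ⟨hpS, hcond⟩ := (hiffδ c hc v (mem_ball.2 (by linarith))).1 hv
  obtain ⟨q, hq1, hq2⟩ := exists_walk_scale (show (0 : ℝ) ≤ r / 4 by positivity) hδ
  -- faces of any walk of `4q` steps stay in `ball c (3r/2)`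
  have near : ∀ (j : Fin 6) (i : ℕ), i ≤ 4 * q → dist ((δ : ℂ) * hexCenter (zdWalk j v i)) c < 3 * r / 2 := by
    intro j i hi
    calc dist ((δ : ℂ) * hexCenter (zdWalk j v i)) c ≤ dist ((δ : ℂ) * hexCenter (zdWalk j v i)) p + dist p c :=
          dist_triangle _ _ _
      _ ≤ (q * Real.sqrt 3 * δ + 3 * δ) + dist p c := by gcongr; exact dist_walk_le j v hδ hi
      _ < (r / 4 + 2 * δ + 3 * δ) + 9 * r / 8 := by linarith
      _ ≤ 3 * r / 2 := by linarith
  -- the end point of a walk and a small ball about it stay in the corner ball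
  have endball : ∀ j : Fin 6, ball (p + ((q * Real.sqrt 3 * δ : ℝ) : ℂ) * innerNormal j) (r / 16) ⊆ ball c (2 * r) := by
    intro j y hy
    have h1 : dist (p + ((q * Real.sqrt 3 * δ : ℝ) : ℂ) * innerNormal j) p ≤ r / 4 + 2 * δ := by
      rw [dist_eq_norm, add_sub_cancel_left, norm_mul, norm_innerNormal, mul_one, Complex.norm_real,
        Real.norm_of_nonneg (by positivity)]; exact hq2
    rw [mem_ball] at hy ⊢
    calc dist y c ≤ dist y (p + ((q * Real.sqrt 3 * δ : ℝ) : ℂ) * innerNormal j) +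
          (dist (p + ((q * Real.sqrt 3 * δ : ℝ) : ℂ) * innerNormal j) p + dist p c) :=
          (dist_triangle _ _ _).trans (by gcongr; exact dist_triangle _ _ _)
      _ < r / 16 + ((r / 4 + 2 * δ) + 9 * r / 8) := by linarith
      _ ≤ 2 * r := by linarith
  rcases Hκ c hc with ⟨hb, hch⟩ | ⟨hb, hch⟩
  · -- convex corner: increase both forms
    obtain ⟨hT1, hT2⟩ := hcond.1 hb
    have hno := corner_not_opposite hr hCor hsep hflat Hκ hc
    obtain ⟨j, hj1, hj2⟩ := exists_near_both hno
    have hpH : p ∈ halfPlane (κ c).1 c ∩ halfPlane (κ c).2.1 c := by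
      have : p ∈ S ∩ ball c (2 * r) := ⟨hpS, mem_ball.2 (by linarith)⟩
      rw [hch] at this; exact this.1
    refine ⟨j, 4 * q, fun i hi => ?_, ?_⟩
    · set w := zdWalk j v i with hw
      have hT1w := hT1.trans (zigzagForm_le_zdWalk j _ hj1 v (Nat.zero_le i))
      have hT2w := hT2.trans (zigzagForm_le_zdWalk j _ hj2 v (Nat.zero_le i))
      have hwS : (δ : ℂ) * hexCenter w ∈ S := by
        have : (δ : ℂ) * hexCenter w ∈ halfPlane (κ c).1 c ∩ halfPlane (κ c).2.1 c ∩ ball c (2 * r) :=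
          ⟨⟨mem_halfPlane_of_zdThr_le _ c hδ w ((hthrδ _ c).trans hT1w),
            mem_halfPlane_of_zdThr_le _ c hδ w ((hthrδ _ c).trans hT2w)⟩, mem_ball.2 (by linarith [near j i hi])⟩
        rw [← hch] at this; exact this.1
      refine (hiffδ c hc w (mem_ball.2 (near j i hi))).2 ⟨hwS, fun _ => ⟨hT1w, hT2w⟩, fun h => ?_⟩
      rw [hb] at h; exact absurd h (by decide)
    · rw [walk_end j v δ q, ← hp]
      refine le_infDist_compl_of_ball_subset hSc fun y hy => ?_
      have hl1 : r / 8 ≤ ((p + ((q * Real.sqrt 3 * δ : ℝ) : ℂ) * innerNormal j - c) * conj (innerNormal (κ c).1)).re := by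
        rw [level_add_real_mul_innerNormal]
        have := (mem_halfPlane_iff_level _ c p).1 hpH.1
        nlinarith
      have hl2 : r / 8 ≤ ((p + ((q * Real.sqrt 3 * δ : ℝ) : ℂ) * innerNormal j - c) * conj (innerNormal (κ c).2.1)).re := by
        rw [level_add_real_mul_innerNormal]
        have := (mem_halfPlane_iff_level _ c p).1 hpH.2
        nlinarith
      have : y ∈ halfPlane (κ c).1 c ∩ halfPlane (κ c).2.1 c ∩ ball c (2 * r) :=
        ⟨⟨ball_subset_halfPlane_of_level _ c _ (r / 16) (by linarith) hy,
          ball_subset_halfPlane_of_level _ c _ (r / 16) (by linarith) hy⟩, endball j hy⟩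
      rw [← hch] at this; exact this.1
  · -- reflex corner: increase the passed form
    have key : ∀ kk : Fin 6, (kk = (κ c).1 ∨ kk = (κ c).2.1) →
        zdT x₁ x₀ ρ r₁ (m δ) (m₀ δ) δ kk c ≤ zigzagForm kk v →
        ∃ (j : Fin 6) (n : ℕ), (∀ i ≤ n, zdWalk j v i ∈ zdLam S Cor κ r x₁ x₀ ρ r₁ Λ m m₀ δ) ∧
          r / 16 ≤ infDist ((δ : ℂ) * hexCenter (zdWalk j v n)) Sᶜ := by
      intro kk hkk hT
      have hsub : halfPlane kk c ⊆ halfPlane (κ c).1 c ∪ halfPlane (κ c).2.1 c := by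
        rcases hkk with rfl | rfl
        · exact subset_union_left
        · exact subset_union_right
      have hpH : p ∈ halfPlane kk c := mem_halfPlane_of_zdThr_le kk c hδ v ((hthrδ kk c).trans hT)
      refine ⟨kk, 4 * q, fun i hi => ?_, ?_⟩
      · set w := zdWalk kk v i with hw
        have hTw := hT.trans (zigzagForm_le_zdWalk kk kk (half_le_inner_self kk) v (Nat.zero_le i))
        have hwS : (δ : ℂ) * hexCenter w ∈ S := by
          have : (δ : ℂ) * hexCenter w ∈ (halfPlane (κ c).1 c ∪ halfPlane (κ c).2.1 c) ∩ ball c (2 * r) :=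
            ⟨hsub (mem_halfPlane_of_zdThr_le kk c hδ w ((hthrδ kk c).trans hTw)), mem_ball.2 (by linarith [near kk i hi])⟩
          rw [← hch] at this; exact this.1
        refine (hiffδ c hc w (mem_ball.2 (near kk i hi))).2 ⟨hwS, fun h => ?_, fun _ => ?_⟩
        · rw [hb] at h; exact absurd h (by decide)
        · rcases hkk with rfl | rfl
          · exact Or.inl hTw
          · exact Or.inr hTw
      · rw [walk_end kk v δ q, ← hp]
        refine le_infDist_compl_of_ball_subset hSc fun y hy => ?_
        have hl : r / 4 ≤ ((p + ((q * Real.sqrt 3 * δ : ℝ) : ℂ) * innerNormal kk - c) * conj (innerNormal kk)).re := by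
          rw [level_add_real_mul_innerNormal_self]
          have := (mem_halfPlane_iff_level kk c p).1 hpH
          linarith
        have : y ∈ (halfPlane (κ c).1 c ∪ halfPlane (κ c).2.1 c) ∩ ball c (2 * r) :=
          ⟨hsub (ball_subset_halfPlane_of_level kk c _ (r / 16) (by linarith) hy), endball kk hy⟩
        rw [← hch] at this; exact this.1
    rcases hcond.2 hb with hT | hT
    · exact key _ (Or.inl rfl) hT
    · exact key _ (Or.inr rfl) hT

/-- **Down-exit near a corner, eventually.** [folklore] -/
theorem eventually_exit_down_corner
    (hA : AdmissibleFamily D ρ Λ m b) (hP : PinnedFlatRoot D Λ b (D.pt 0) a r₀ m₀)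
    (hSo : IsOpen S) (hSD : S ⊆ D.carrier) (hSne : S.Nonempty) (hr : 0 < r) (hrρ : r ≤ ρ / 16) (hrr₁ : r ≤ r₁ / 16)
    (hr₁r₀ : r₁ ≤ r₀)
    (hD0 : D.carrier ∩ ball (D.pt 0) r₁ = {z : ℂ | (D.pt 0).im < z.im} ∩ ball (D.pt 0) r₁)
    (hF : ∀ w ∈ frontier S, w ∉ ball (D.pt 1) (15 * ρ / 16) → w ∉ ball (D.pt 0) (15 * r₁ / 16) → w ∈ D.carrier)
    (hdist : ρ + r₁ ≤ dist (D.pt 0) (D.pt 1))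
    (hCor : ∀ c ∈ Cor, c ∈ frontier S)
    (hsep : ∀ c ∈ Cor, ∀ c' ∈ Cor, c ≠ c' → 4 * r ≤ dist c c')
    (hflat : ∀ z ∈ frontier S, (∀ c ∈ Cor, r ≤ dist z c) → ∃ k : Fin 6, S ∩ ball z (r / 2) = halfPlane k z ∩ ball z (r / 2))
    (Hκ : ∀ c ∈ Cor, ((κ c).2.2 = true ∧ S ∩ ball c (2 * r) = halfPlane (κ c).1 c ∩ halfPlane (κ c).2.1 c ∩ ball c (2 * r)) ∨
      ((κ c).2.2 = false ∧ S ∩ ball c (2 * r) = (halfPlane (κ c).1 c ∪ halfPlane (κ c).2.1 c) ∩ ball c (2 * r))) :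
    ∀ᶠ δ : ℝ in 𝓝[>] 0, ∀ c ∈ Cor, ∀ v : HexVertex, v ∉ zdLam S Cor κ r (D.pt 1) (D.pt 0) ρ r₁ Λ m m₀ δ →
      (δ : ℂ) * hexCenter v ∈ ball c (9 * r / 8) →
      ∃ (j : Fin 6) (n : ℕ), (∀ i ≤ n, zdWalk j v i ∉ zdLam S Cor κ r (D.pt 1) (D.pt 0) ρ r₁ Λ m m₀ δ) ∧
        r / 16 ≤ infDist ((δ : ℂ) * hexCenter (zdWalk j v n)) (closure S) ∧
        dist ((δ : ℂ) * hexCenter (zdWalk j v n)) ((δ : ℂ) * hexCenter v) ≤ r := by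
  have hiff := eventually_zdLam_iff_corner hA hP hSo hSD hr hrρ hrr₁ hr₁r₀ hD0 hF hdist hCor hsep hflat Hκ
  have hthr := eventually_zdThr_le_zdT hA hP ρ r₁
  have hfloat := eventually_delta_mul_float_le hA hP (show (0 : ℝ) < r / 32 by positivity)
  have hδ1 : ∀ᶠ δ : ℝ in 𝓝[>] 0, δ ∈ Ioo (0 : ℝ) (r / 200) := Ioo_mem_nhdsGT (by positivity)
  filter_upwards [hiff, hthr, hfloat, hδ1] with δ hiffδ hthrδ hflδ hδδ c hc v hv hpc
  obtain ⟨hδ, hδr⟩ := hδδ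
  set x₁ := D.pt 1
  set x₀ := D.pt 0
  have hU0 : (0 : ℝ) ≤ (|m δ - zdThr 0 x₁ δ| + |m₀ δ - zdThr 0 x₀ δ| + 2 : ℤ) := by
    have h1 := abs_nonneg (m δ - zdThr 0 x₁ δ); have h2 := abs_nonneg (m₀ δ - zdThr 0 x₀ δ)
    have : (0 : ℤ) ≤ |m δ - zdThr 0 x₁ δ| + |m₀ δ - zdThr 0 x₀ δ| + 2 := by linarith
    exact_mod_cast this
  have hmargin := margin_le_of_small hδ (by linarith) hflδ hU0
  set p : ℂ := (δ : ℂ) * hexCenter v with hp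
  have hpc' : dist p c < 9 * r / 8 := mem_ball.1 hpc
  have hneg : ¬ ((δ : ℂ) * hexCenter v ∈ S ∧
      (((κ c).2.2 = true → zdT x₁ x₀ ρ r₁ (m δ) (m₀ δ) δ (κ c).1 c ≤ zigzagForm (κ c).1 v ∧
          zdT x₁ x₀ ρ r₁ (m δ) (m₀ δ) δ (κ c).2.1 c ≤ zigzagForm (κ c).2.1 v) ∧
        ((κ c).2.2 = false → zdT x₁ x₀ ρ r₁ (m δ) (m₀ δ) δ (κ c).1 c ≤ zigzagForm (κ c).1 v ∨
          zdT x₁ x₀ ρ r₁ (m δ) (m₀ δ) δ (κ c).2.1 c ≤ zigzagForm (κ c).2.1 v))) :=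
    fun h => hv ((hiffδ c hc v (mem_ball.2 (by linarith))).2 h)
  -- a failed test means a shallow face
  have shallow : ∀ kk : Fin 6, ¬ zdT x₁ x₀ ρ r₁ (m δ) (m₀ δ) δ kk c ≤ zigzagForm kk v →
      ((p - c) * conj (innerNormal kk)).re ≤ r / 16 := by
    intro kk hfail
    by_contra hcon
    push Not at hcon
    exact hfail (zdT_le_of_lt_level x₁ x₀ ρ r₁ (m δ) (m₀ δ) hδ kk c v (by rw [← hp]; linarith))
  obtain ⟨q, hq1, hq2⟩ := exists_walk_scale (show (0 : ℝ) ≤ r / 4 by positivity) hδ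
  have near : ∀ (j : Fin 6) (i : ℕ), i ≤ 4 * q → dist ((δ : ℂ) * hexCenter (zdWalk j v i)) c < 3 * r / 2 := by
    intro j i hi
    calc dist ((δ : ℂ) * hexCenter (zdWalk j v i)) c ≤ dist ((δ : ℂ) * hexCenter (zdWalk j v i)) p + dist p c :=
          dist_triangle _ _ _
      _ ≤ (q * Real.sqrt 3 * δ + 3 * δ) + dist p c := by gcongr; exact dist_walk_le j v hδ hi
      _ < (r / 4 + 2 * δ + 3 * δ) + 9 * r / 8 := by linarith
      _ ≤ 3 * r / 2 := by linarith
  have endball : ∀ j : Fin 6, ball (p + ((q * Real.sqrt 3 * δ : ℝ) : ℂ) * innerNormal j) (r / 16) ⊆ ball c (2 * r) := by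
    intro j y hy
    have h1 : dist (p + ((q * Real.sqrt 3 * δ : ℝ) : ℂ) * innerNormal j) p ≤ r / 4 + 2 * δ := by
      rw [dist_eq_norm, add_sub_cancel_left, norm_mul, norm_innerNormal, mul_one, Complex.norm_real,
        Real.norm_of_nonneg (by positivity)]; exact hq2
    rw [mem_ball] at hy ⊢
    calc dist y c ≤ dist y (p + ((q * Real.sqrt 3 * δ : ℝ) : ℂ) * innerNormal j) +
          (dist (p + ((q * Real.sqrt 3 * δ : ℝ) : ℂ) * innerNormal j) p + dist p c) :=
          (dist_triangle _ _ _).trans (by gcongr; exact dist_triangle _ _ _)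
      _ < r / 16 + ((r / 4 + 2 * δ) + 9 * r / 8) := by linarith
      _ ≤ 2 * r := by linarith
  -- levels in a small ball about the end point
  have ballev : ∀ (j kk : Fin 6) (y : ℂ), y ∈ ball (p + ((q * Real.sqrt 3 * δ : ℝ) : ℂ) * innerNormal j) (r / 16) →
      ((y - c) * conj (innerNormal kk)).re < ((p - c) * conj (innerNormal kk)).re +
        q * Real.sqrt 3 * δ * (innerNormal j * conj (innerNormal kk)).re + r / 16 := by
    intro j kk y hy
    rw [level_split (innerNormal kk) y c (p + ((q * Real.sqrt 3 * δ : ℝ) : ℂ) * innerNormal j), level_add_real_mul_innerNormal]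
    have h1 := abs_level_le_dist kk (p + ((q * Real.sqrt 3 * δ : ℝ) : ℂ) * innerNormal j) y
    have h2 := le_abs_self ((y - (p + ((q * Real.sqrt 3 * δ : ℝ) : ℂ) * innerNormal j)) * conj (innerNormal kk)).re
    rw [mem_ball] at hy
    linarith
  rcases Hκ c hc with ⟨hb, hch⟩ | ⟨hb, hch⟩
  · -- convex corner: some form fails; decrease it
    have key : ∀ kk : Fin 6, (kk = (κ c).1 ∨ kk = (κ c).2.1) → ¬ zdT x₁ x₀ ρ r₁ (m δ) (m₀ δ) δ kk c ≤ zigzagForm kk v →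
        ∃ (j : Fin 6) (n : ℕ), (∀ i ≤ n, zdWalk j v i ∉ zdLam S Cor κ r x₁ x₀ ρ r₁ Λ m m₀ δ) ∧
          r / 16 ≤ infDist ((δ : ℂ) * hexCenter (zdWalk j v n)) (closure S) ∧
          dist ((δ : ℂ) * hexCenter (zdWalk j v n)) ((δ : ℂ) * hexCenter v) ≤ r := by
      intro kk hkk hfail
      have hsup : halfPlane (κ c).1 c ∩ halfPlane (κ c).2.1 c ⊆ halfPlane kk c := by
        rcases hkk with rfl | rfl
        · exact inter_subset_left
        · exact inter_subset_right
      refine ⟨zdOpp kk, 4 * q, fun i hi hwin => ?_, ?_, (dist_walk_le _ v hδ le_rfl).trans (by linarith)⟩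
      · set w := zdWalk (zdOpp kk) v i with hw
        have hfw : zigzagForm kk w ≤ zigzagForm kk v := by
          have := zigzagForm_le_zdWalk (zdOpp kk) (zdOpp kk) (half_le_inner_self _) v (Nat.zero_le i)
          rw [zdWalk_zero, zigzagForm_zdOpp, zigzagForm_zdOpp] at this
          linarith
        obtain ⟨-, hcondw⟩ := (hiffδ c hc w (mem_ball.2 (near _ i hi))).1 hwin
        obtain ⟨h1, h2⟩ := hcondw.1 hb
        rcases hkk with rfl | rfl
        · exact hfail (h1.trans hfw)
        · exact hfail (h2.trans hfw)
      · rw [walk_end (zdOpp kk) v δ q, ← hp]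
        have hlev := shallow kk hfail
        refine le_infDist_closure_of_disjoint hSne.closure (disjoint_left.2 fun y hy hyS => ?_)
        have hyB := endball (zdOpp kk) hy
        have : y ∈ S ∩ ball c (2 * r) := ⟨hyS, hyB⟩
        rw [hch] at this
        have hyl := (mem_halfPlane_iff_level kk c y).1 (hsup this.1)
        have := ballev (zdOpp kk) kk y hy
        rw [innerNormal_zdOpp, neg_mul, Complex.neg_re, re_innerNormal_mul_conj] at this
        linarith
    by_cases hT1 : zdT x₁ x₀ ρ r₁ (m δ) (m₀ δ) δ (κ c).1 c ≤ zigzagForm (κ c).1 v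
    · by_cases hT2 : zdT x₁ x₀ ρ r₁ (m δ) (m₀ δ) δ (κ c).2.1 c ≤ zigzagForm (κ c).2.1 v
      · exfalso
        apply hneg
        have hpS : p ∈ S := by
          have : p ∈ halfPlane (κ c).1 c ∩ halfPlane (κ c).2.1 c ∩ ball c (2 * r) :=
            ⟨⟨mem_halfPlane_of_zdThr_le _ c hδ v ((hthrδ _ c).trans hT1),
              mem_halfPlane_of_zdThr_le _ c hδ v ((hthrδ _ c).trans hT2)⟩, mem_ball.2 (by linarith)⟩
          rw [← hch] at this; exact this.1
        exact ⟨hpS, fun _ => ⟨hT1, hT2⟩, fun h => by rw [hb] at h; exact absurd h (by decide)⟩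
      · exact key _ (Or.inr rfl) hT2
    · exact key _ (Or.inl rfl) hT1
  · -- reflex corner: both forms fail; decrease both
    have hfails : ∀ kk : Fin 6, (kk = (κ c).1 ∨ kk = (κ c).2.1) → ¬ zdT x₁ x₀ ρ r₁ (m δ) (m₀ δ) δ kk c ≤ zigzagForm kk v := by
      intro kk hkk hT
      apply hneg
      have hsub : halfPlane kk c ⊆ halfPlane (κ c).1 c ∪ halfPlane (κ c).2.1 c := by
        rcases hkk with rfl | rfl
        · exact subset_union_left
        · exact subset_union_right
      have hpS : p ∈ S := by
        have : p ∈ (halfPlane (κ c).1 c ∪ halfPlane (κ c).2.1 c) ∩ ball c (2 * r) :=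
          ⟨hsub (mem_halfPlane_of_zdThr_le kk c hδ v ((hthrδ kk c).trans hT)), mem_ball.2 (by linarith)⟩
        rw [← hch] at this; exact this.1
      refine ⟨hpS, fun h => by rw [hb] at h; exact absurd h (by decide), fun _ => ?_⟩
      rcases hkk with rfl | rfl
      · exact Or.inl hT
      · exact Or.inr hT
    have hf1 := hfails _ (Or.inl rfl)
    have hf2 := hfails _ (Or.inr rfl)
    have hno := corner_not_opposite hr hCor hsep hflat Hκ hc
    have hno' : (innerNormal (zdOpp (κ c).1) * conj (innerNormal (zdOpp (κ c).2.1))).re ≠ -1 := by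
      rwa [inner_zdOpp_zdOpp]
    obtain ⟨j, hj1, hj2⟩ := exists_near_both hno'
    refine ⟨j, 4 * q, fun i hi hwin => ?_, ?_, (dist_walk_le _ v hδ le_rfl).trans (by linarith)⟩
    · set w := zdWalk j v i with hw
      have hf1w : zigzagForm (κ c).1 w ≤ zigzagForm (κ c).1 v := by
        have := zigzagForm_le_zdWalk j _ hj1 v (Nat.zero_le i)
        rw [zdWalk_zero, zigzagForm_zdOpp, zigzagForm_zdOpp] at this
        linarith
      have hf2w : zigzagForm (κ c).2.1 w ≤ zigzagForm (κ c).2.1 v := by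
        have := zigzagForm_le_zdWalk j _ hj2 v (Nat.zero_le i)
        rw [zdWalk_zero, zigzagForm_zdOpp, zigzagForm_zdOpp] at this
        linarith
      obtain ⟨-, hcondw⟩ := (hiffδ c hc w (mem_ball.2 (near _ i hi))).1 hwin
      rcases hcondw.2 hb with h | h
      · exact hf1 (h.trans hf1w)
      · exact hf2 (h.trans hf2w)
    · rw [walk_end j v δ q, ← hp]
      have hl1 := shallow _ hf1
      have hl2 := shallow _ hf2
      have hg1 : (innerNormal j * conj (innerNormal (κ c).1)).re ≤ -(1 / 2) := by
        have := inner_zdOpp_right j (κ c).1; linarith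
      have hg2 : (innerNormal j * conj (innerNormal (κ c).2.1)).re ≤ -(1 / 2) := by
        have := inner_zdOpp_right j (κ c).2.1; linarith
      have hqpos : 0 ≤ q * Real.sqrt 3 * δ := by positivity
      refine le_infDist_closure_of_disjoint hSne.closure (disjoint_left.2 fun y hy hyS => ?_)
      have hyB := endball j hy
      have : y ∈ S ∩ ball c (2 * r) := ⟨hyS, hyB⟩
      rw [hch] at this
      have e1 := ballev j (κ c).1 y hy
      have e2 := ballev j (κ c).2.1 y hy
      rcases this.1 with h | h
      · have hyl := (mem_halfPlane_iff_level _ c y).1 h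
        nlinarith
      · have hyl := (mem_halfPlane_iff_level _ c y).1 h
        nlinarith

end Exits

/-- **Two non-opposite forms have a direction near both** (registered form, sub-goal of `stub_innerPolygonsOfZigzag`). [folklore] -/
theorem zd_exists_near_both : ∀ (k₁ k₂ : Fin 6), (innerNormal k₁ * (starRingEnd ℂ) (innerNormal k₂)).re ≠ -1 → ∃ j : Fin 6, 1 / 2 ≤ (innerNormal j * (starRingEnd ℂ) (innerNormal k₁)).re ∧ 1 / 2 ≤ (innerNormal j * (starRingEnd ℂ) (innerNormal k₂)).re :=
  fun _ _ hno => exists_near_both hno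

end Summit.CriticalPhenomena.SAWScalingLimit.Theorems.PolygonParitySqueeze.ZigzagDiscretisation

end
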